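import Summits.BirchSwinnertonDyer.BirchSwinnertonDyer.Theorems.Rank1ResidualJetRingClassFields
import Literature.NumberTheory.EllipticCurves.HeegnerPointsKolyvaginDivisibilityIndexManin
import HarnessLib

/-!
# Route `KolyvaginDepthDoor`, crux `KolyvaginDepthSupplyKN` (stmt-BirchSwinnertonDyer-22820) —
# the two Zanarella bridge records compared: the Selmer-module form IMPLIES the full-`H¹` form

Helper file of the lead prover of line `levelone` (kdd-p1 g13; `--supports stmt-BirchSwinnertonDyer-22820
--as helper`); it closes nothing and BSD is not proved by it.

The tree now holds two transcriptions of Zanarella 2019, Prop. 2.18 («`∂^{(∞)}(κ) = 0` is the same as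
`κ^{(1)} ≠ 0`»): `Zanarella2019_kolyvaginClass_one_ne_zero_of_not_divisible` (p669363; hypothesis: a
class `c_{M(n)}(n)` not divisible by `p` in the FULL `H¹(K, E[p^{M(n)}])`) and
`Zanarella2019_kolyvaginClass_one_ne_zero_of_not_selmerDivisible` (p678349; hypothesis: not divisible by
`p` INSIDE the modified Selmer module `H¹_{𝓕(n)}(K, E[p^{M(n)}])`, the printed `∂^{(∞)}`). Since the
Selmer module is a subgroup of `H¹`, non-divisibility in `H¹` implies non-divisibility in the Selmer
module, so the second record (weaker hypothesis) implies the first: the tree's debt for the pair is ONE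
statement. The ring-class-field instance binder of the second record is discharged by
`Summit.BirchSwinnertonDyer.Rank1Residual.JET.numberField_ringClassField`.

* `zanarella_not_divisible_of_not_selmerDivisible` — record p678349 ⟹ record p669363. UNCONDITIONAL
  implication between named facts; BSD is not proved by it.

References: [Zanarella2019] Def. 2.17, Prop. 2.18 (arXiv:1908.09197); [Cox2013] §9.A.
-/

set_option linter.dupNamespace false

noncomputable section

open scoped Classical

namespace Summit.BirchSwinnertonDyer.BirchSwinnertonDyer.Theorems.KolyvaginDepthDoor

open Literature.NumberTheory.EllipticCurves Literature.NumberTheory.EllipticCurves.ModularForms WeierstrassCurve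

/-- **The Selmer-module form of Zanarella's bridge implies the full-`H¹` form** (a class not divisible by
`p` in `H¹(K, E[p^M])` is a fortiori not divisible by `p` inside the subgroup `H¹_{𝓕(n)}`).
UNCONDITIONAL. [cite: Zanarella2019, Def. 2.17, Prop. 2.18 (arXiv:1908.09197 §2.3)] -/
theorem zanarella_not_divisible_of_not_selmerDivisible
    (hZ : Literature.NumberTheory.EllipticCurves.Zanarella2019_kolyvaginClass_one_ne_zero_of_not_selmerDivisible) :
    Literature.NumberTheory.EllipticCurves.Zanarella2019_kolyvaginClass_one_ne_zero_of_not_divisible := by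
  intro W _ _ p hp h5 hgood hord hsur K _ _ hK hlt hpD hDN _ hH Dt β ι n d M hn1 hsupp hM hndiv
  haveI : ∀ k : ℕ, NumberField (ringClassField K ι k) := fun k ↦
    Summit.BirchSwinnertonDyer.Rank1Residual.JET.numberField_ringClassField K hK ι k
  exact hZ W p h5 hgood hord hsur K hK hlt hpD hDN hH Dt β ι n d M hn1 hsupp hM
    (fun ⟨ξ, _, hξ⟩ ↦ hndiv ⟨ξ, hξ⟩)

end Summit.BirchSwinnertonDyer.BirchSwinnertonDyer.Theorems.KolyvaginDepthDoor

end
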